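import Mathlib.Topology.Algebra.Ring.Basic
import Mathlib.Topology.Algebra.ContinuousMonoidHom
import Mathlib.Topology.Algebra.Group.Basic
import Mathlib.Algebra.Ring.Subring.Basic
import Mathlib.Algebra.Ring.Idempotent
import Mathlib.Tactic.NoncommRing
import HarnessLib

/-!
# The unit group of a ring splits along a central idempotent: `Rˣ ≅ U_e × U_{1-e}`

Topic `Topology/Algebra`; small definitions with bodies (`cornerMonoidHom`, `cornerUnits`,
`toCornerUnits`, `unitsEquivCornerUnitsProd`, `unitsContinuousEquivCornerUnitsProd`) and theorems;
no named fact, no instance.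

Let `R` be a ring and `e ∈ R` a **central idempotent**, so that `R = eR × (1-e)R` is the Peirce
decomposition of `R` into two two-sided ideals which are rings with units `e`, `1 - e`
(Lam, *A first course in noncommutative rings*, §21; Mathlib `IsIdempotentElem.Corner`,
`CompleteOrthogonalIdempotents.ringEquivOfIsMulCentral`). On unit groups this gives an **internal
direct product decomposition** `Rˣ = U_e · U_{1-e}`, `U_e ∩ U_{1-e} = 1`, where
`U_e = {u ∈ Rˣ : (1 - e) u = 1 - e}` is the group of units "supported on `e`" (`u = e u + (1 - e)`),
with the projection `u ↦ e u + (1 - e)` (a monoid endomorphism of `R`):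

* `cornerMonoidHom` — `x ↦ e x + (1 - e)` is a monoid homomorphism `R →* R`;
* `cornerUnits e = U_e ≤ Rˣ`, `toCornerUnits : Rˣ →* U_e` (`Units.map` of `cornerMonoidHom`);
* `unitsEquivCornerUnitsProd : Rˣ ≃* U_e × U_{1-e}`, `u ↦ (e u + (1 - e), (1 - e) u + e)`, with
  inverse the product — and its topological form `unitsContinuousEquivCornerUnitsProd : Rˣ ≃ₜ* U_e × U_{1-e}`
  for a topological ring `R` (units topologies throughout);
* `cornerUnits_eq_ker` (`U_e = ker (u ↦ (1 - e) u + e)`), `isClosed_cornerUnits`,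
  `commute_of_mem_cornerUnits` (`U_e` and `U_{1-e}` commute elementwise).

This is the abstract form of the decompositions `GL_n(𝔸_K) = GL_n(K_S) × GL_n(𝔸_K^S)`
(`e = e_S · 1_n` the idempotent of the places of `S`; Bump (1997), §3.3, "`GL(n, 𝔸) = GL(n, F_v) × GL(n, 𝔸^v)`";
the tree's `GLn.placeSplitting`, `GLn.placesSplitting`) and `D_𝔸ˣ = D_Sˣ × D^{S,×}` for a quaternion
algebra `D` (`e = e_S ⊗ 1 ∈ 𝔸_K ⊗_K D`; Gelbart (1975), §10, p. 153: "`G_𝔸 = G_S × G^S`" on both sides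
of the comparison of trace formulas), which is the use it is put to in
`Literature/NumberTheory/Automorphic` (inline decomposition, D-0026, of
`Literature.NumberTheory.Automorphic.strong_multiplicity_one_quaternionUnits`).

## References

* T. Y. Lam, *A first course in noncommutative rings*, 2nd ed., GTM 131 (2001), §21 (Peirce
  decompositions) — folklore.
* D. Bump, *Automorphic forms and representations* (1997), §3.3 [Bump1997].
* S. Gelbart, *Automorphic forms on adele groups* (1975), §10, p. 153 [Gelbart1975].
-/

namespace Literature.Topology.Algebra

section Ring

variable {R : Type*} [Ring R] {e : R}

/-- `1 - e` is central when `e` is. [folklore] -/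
theorem one_sub_mem_center (hc : e ∈ Subring.center R) : 1 - e ∈ Subring.center R :=
  sub_mem (Subring.center R).one_mem hc

/-- `e (1 - e) = 0` for an idempotent `e`. [folklore] -/
theorem mul_one_sub_eq_zero (he : IsIdempotentElem e) : e * (1 - e) = 0 := by
  rw [mul_sub, mul_one, he.eq, sub_self]

/-- `(1 - e) e = 0` for an idempotent `e`. [folklore] -/
theorem one_sub_mul_eq_zero (he : IsIdempotentElem e) : (1 - e) * e = 0 := by
  rw [sub_mul, one_mul, he.eq, sub_self]

/-- **The Peirce projection `x ↦ e x + (1 - e)` is a monoid endomorphism of `R`** for a central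
idempotent `e`: `(e x + 1 - e)(e y + 1 - e) = e x y + 1 - e` and `e · 1 + 1 - e = 1`. [folklore] -/
def cornerMonoidHom (he : IsIdempotentElem e) (hc : e ∈ Subring.center R) : R →* R where
  toFun x := e * x + (1 - e)
  map_one' := by rw [mul_one, add_sub_cancel]
  map_mul' x y := by
    have hxe : x * e = e * x := Subring.mem_center_iff.1 hc x
    have key : (e * x + (1 - e)) * (e * y + (1 - e)) =
        e * (x * e) * y - e * (x * e) + e * x + (e * y - e * e * y) + (1 - e - e + e * e) := by
      noncomm_ring
    rw [key, hxe, ← mul_assoc e e x, he.eq]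
    noncomm_ring

/-- `cornerMonoidHom he hc x = e x + (1 - e)` (definitional). [folklore] -/
@[simp]
theorem cornerMonoidHom_apply (he : IsIdempotentElem e) (hc : e ∈ Subring.center R) (x : R) :
    cornerMonoidHom he hc x = e * x + (1 - e) := rfl

variable (e) in
/-- **The units supported on `e`**: `U_e = {u ∈ Rˣ : (1 - e) u = 1 - e}` (equivalently
`u = e u + (1 - e)`), a subgroup of `Rˣ`; for `R = eR × (1 - e)R` it is the unit group of the
corner `eR` embedded by `w ↦ w + (1 - e)`. [folklore] -/
def cornerUnits : Subgroup Rˣ where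
  carrier := {u | (1 - e) * (u : R) = 1 - e}
  one_mem' := by simp
  mul_mem' {u v} hu hv := by
    change (1 - e) * (u : R) = 1 - e at hu
    change (1 - e) * (v : R) = 1 - e at hv
    change (1 - e) * ((u : R) * v) = 1 - e
    rw [← mul_assoc, hu, hv]
  inv_mem' {u} hu := by
    change (1 - e) * (u : R) = 1 - e at hu
    change (1 - e) * ((u⁻¹ : Rˣ) : R) = 1 - e
    calc (1 - e) * ((u⁻¹ : Rˣ) : R) = (1 - e) * u * ((u⁻¹ : Rˣ) : R) := by rw [hu]
      _ = 1 - e := by rw [mul_assoc, Units.mul_inv, mul_one]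

/-- Membership in `U_e` (definitional). [folklore] -/
theorem mem_cornerUnits_iff {u : Rˣ} : u ∈ cornerUnits e ↔ (1 - e) * (u : R) = 1 - e := Iff.rfl

/-- `U_{1 - (1 - e)} = U_e`. [folklore] -/
theorem cornerUnits_one_sub_one_sub : cornerUnits (1 - (1 - e)) = cornerUnits e := by
  rw [sub_sub_cancel]

/-- Transport of membership along `1 - (1 - e) = e`. [folklore] -/
theorem mem_cornerUnits_one_sub_one_sub {u : Rˣ} (hu : u ∈ cornerUnits e) : u ∈ cornerUnits (1 - (1 - e)) := by
  rw [sub_sub_cancel]; exact hu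

/-- `u ∈ U_e` iff `u = e u + (1 - e)`. [folklore] -/
theorem mem_cornerUnits_iff_eq {u : Rˣ} : u ∈ cornerUnits e ↔ (u : R) = e * u + (1 - e) := by
  rw [mem_cornerUnits_iff]
  constructor
  · intro h
    calc (u : R) = (e + (1 - e)) * u := by rw [add_sub_cancel, one_mul]
      _ = e * u + (1 - e) := by rw [add_mul, h]
  · intro h
    have h' : (1 - e) * (u : R) = u - e * u := by rw [sub_mul, one_mul]
    rw [h', sub_eq_iff_eq_add, add_comm]
    exact h

/-- **The projection `Rˣ →* U_e`, `u ↦ e u + (1 - e)`** (`Units.map` of `cornerMonoidHom`). [folklore] -/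
def toCornerUnits (he : IsIdempotentElem e) (hc : e ∈ Subring.center R) : Rˣ →* cornerUnits e :=
  (Units.map (cornerMonoidHom he hc)).codRestrict (cornerUnits e) fun u => by
    rw [mem_cornerUnits_iff, Units.coe_map, cornerMonoidHom_apply, mul_add,
      ← mul_assoc, one_sub_mul_eq_zero he, zero_mul, zero_add, he.one_sub.eq]

/-- `toCornerUnits he hc u = e u + (1 - e)` in `R` (definitional). [folklore] -/
@[simp]
theorem coe_toCornerUnits (he : IsIdempotentElem e) (hc : e ∈ Subring.center R) (u : Rˣ) :
    (((toCornerUnits he hc u : cornerUnits e) : Rˣ) : R) = e * u + (1 - e) := rfl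

/-- The projection fixes `U_e`. [folklore] -/
theorem toCornerUnits_of_mem (he : IsIdempotentElem e) (hc : e ∈ Subring.center R) {u : Rˣ}
    (hu : u ∈ cornerUnits e) : toCornerUnits he hc u = ⟨u, hu⟩ :=
  Subtype.ext (Units.ext (by rw [coe_toCornerUnits]; exact (mem_cornerUnits_iff_eq.1 hu).symm))

/-- The projection kills `U_{1-e}`. [folklore] -/
theorem toCornerUnits_eq_one_of_mem (he : IsIdempotentElem e) (hc : e ∈ Subring.center R) {u : Rˣ}
    (hu : u ∈ cornerUnits (1 - e)) : toCornerUnits he hc u = 1 := by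
  refine Subtype.ext (Units.ext ?_)
  rw [mem_cornerUnits_iff, sub_sub_cancel] at hu
  rw [coe_toCornerUnits, hu, OneMemClass.coe_one, Units.val_one, add_sub_cancel]

/-- `U_e = ker (u ↦ (1 - e) u + e)`. [folklore] -/
theorem mem_cornerUnits_iff_toCornerUnits_eq_one (he : IsIdempotentElem e) (hc : e ∈ Subring.center R)
    {u : Rˣ} : u ∈ cornerUnits e ↔ toCornerUnits he.one_sub (one_sub_mem_center hc) u = 1 := by
  constructor
  · intro hu
    exact toCornerUnits_eq_one_of_mem _ _ (mem_cornerUnits_one_sub_one_sub hu)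
  · intro h
    have h' := congrArg (fun w : cornerUnits (1 - e) => ((w : Rˣ) : R)) h
    simp only [coe_toCornerUnits, sub_sub_cancel, OneMemClass.coe_one, Units.val_one] at h'
    rw [mem_cornerUnits_iff]
    calc (1 - e) * (u : R) = (1 - e) * u + e - e := by rw [add_sub_cancel_right]
      _ = 1 - e := by rw [h']

/-- **`Rˣ ≅ U_e × U_{1-e}`**: the unit group of `R` is the internal direct product of the units
supported on `e` and on `1 - e`; `u ↦ (e u + (1 - e), (1 - e) u + e)`, with inverse
`(a, b) ↦ a b` (`(R₁ × R₂)ˣ = R₁ˣ × R₂ˣ` for the Peirce decomposition `R = eR × (1 - e)R`).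
[folklore] -/
def unitsEquivCornerUnitsProd (he : IsIdempotentElem e) (hc : e ∈ Subring.center R) :
    Rˣ ≃* cornerUnits e × cornerUnits (1 - e) :=
  { (toCornerUnits he hc).prod (toCornerUnits he.one_sub (one_sub_mem_center hc)) with
    invFun := fun p => (p.1 : Rˣ) * (p.2 : Rˣ)
    left_inv := fun u => by
      refine Units.ext ?_
      have hue : (u : R) * e = e * u := Subring.mem_center_iff.1 hc u
      have hu1 : (u : R) * (1 - e) = (1 - e) * u := Subring.mem_center_iff.1 (one_sub_mem_center hc) u
      change (((toCornerUnits he hc u : cornerUnits e) : Rˣ) *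
        ((toCornerUnits he.one_sub (one_sub_mem_center hc) u : cornerUnits (1 - e)) : Rˣ) : R) = u
      rw [coe_toCornerUnits, coe_toCornerUnits, sub_sub_cancel]
      have key : (e * u + (1 - e)) * ((1 - e) * u + e) =
          e * (u * (1 - e)) * u + e * (u * e) + (1 - e) * (1 - e) * u + (1 - e) * e := by
        noncomm_ring
      rw [key, hu1, hue, ← mul_assoc e (1 - e) (u : R), mul_one_sub_eq_zero he, ← mul_assoc e e (u : R),
        he.eq, he.one_sub.eq, one_sub_mul_eq_zero he]
      noncomm_ring
    right_inv := fun p => by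
      obtain ⟨⟨a, ha⟩, ⟨b, hb⟩⟩ := p
      have ha' : (1 - e) * (a : R) = 1 - e := ha
      have hb' : e * (b : R) = e := by
        have := mem_cornerUnits_iff.1 hb
        rwa [sub_sub_cancel] at this
      have hae : (a : R) * e = e * a := Subring.mem_center_iff.1 hc a
      refine Prod.ext (Subtype.ext (Units.ext ?_)) (Subtype.ext (Units.ext ?_))
      · change e * ((a : R) * b) + (1 - e) = a
        calc e * ((a : R) * b) + (1 - e) = a * (e * b) + (1 - e) := by rw [← mul_assoc, ← hae, mul_assoc]
          _ = e * a + (1 - e) * a := by rw [hb', hae, ha']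
          _ = a := by rw [← add_mul, add_sub_cancel, one_mul]
      · change (1 - e) * ((a : R) * b) + (1 - (1 - e)) = b
        calc (1 - e) * ((a : R) * b) + (1 - (1 - e)) = (1 - e) * a * b + e := by rw [mul_assoc, sub_sub_cancel]
          _ = (1 - e) * b + e * b := by rw [ha', hb']
          _ = b := by rw [← add_mul, sub_add_cancel, one_mul] }

/-- The splitting is `u ↦ (e u + (1 - e), (1 - e) u + e)` (definitional). [folklore] -/
@[simp]
theorem unitsEquivCornerUnitsProd_apply (he : IsIdempotentElem e) (hc : e ∈ Subring.center R) (u : Rˣ) :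
    unitsEquivCornerUnitsProd he hc u =
      (toCornerUnits he hc u, toCornerUnits he.one_sub (one_sub_mem_center hc) u) := rfl

/-- The inverse splitting is the product `(a, b) ↦ a b` (definitional). [folklore] -/
@[simp]
theorem unitsEquivCornerUnitsProd_symm_apply (he : IsIdempotentElem e) (hc : e ∈ Subring.center R)
    (p : cornerUnits e × cornerUnits (1 - e)) :
    (unitsEquivCornerUnitsProd he hc).symm p = (p.1 : Rˣ) * (p.2 : Rˣ) := rfl

/-- `u = (e u + (1 - e)) ((1 - e) u + e)`. [folklore] -/
theorem toCornerUnits_mul_toCornerUnits (he : IsIdempotentElem e) (hc : e ∈ Subring.center R) (u : Rˣ) :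
    ((toCornerUnits he hc u : cornerUnits e) : Rˣ) *
      ((toCornerUnits he.one_sub (one_sub_mem_center hc) u : cornerUnits (1 - e)) : Rˣ) = u :=
  (unitsEquivCornerUnitsProd he hc).symm_apply_apply u

/-- **`U_e` and `U_{1-e}` commute elementwise** (they are the two factors of a direct product
decomposition of `Rˣ`). [folklore] -/
theorem commute_of_mem_cornerUnits (he : IsIdempotentElem e) (hc : e ∈ Subring.center R) {a b : Rˣ}
    (ha : a ∈ cornerUnits e) (hb : b ∈ cornerUnits (1 - e)) : Commute a b := by
  set Φ := unitsEquivCornerUnitsProd he hc with hΦ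
  have h1 : Φ a = (⟨a, ha⟩, 1) :=
    Prod.ext (toCornerUnits_of_mem he hc ha)
      (toCornerUnits_eq_one_of_mem _ _ (mem_cornerUnits_one_sub_one_sub ha))
  have h2 : Φ b = (1, ⟨b, hb⟩) :=
    Prod.ext (toCornerUnits_eq_one_of_mem he hc hb) (toCornerUnits_of_mem _ _ hb)
  refine Φ.injective ?_
  rw [map_mul, map_mul, h1, h2, Prod.mk_mul_mk, Prod.mk_mul_mk, one_mul, mul_one, one_mul, mul_one]

/-- `U_e ∩ U_{1-e} = 1`. [folklore] -/
theorem cornerUnits_inf_cornerUnits_one_sub (he : IsIdempotentElem e) (hc : e ∈ Subring.center R) :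
    cornerUnits e ⊓ cornerUnits (1 - e) = ⊥ := by
  refine (Subgroup.eq_bot_iff_forall _).2 fun u hu => ?_
  have h := toCornerUnits_mul_toCornerUnits he hc u
  rw [toCornerUnits_eq_one_of_mem he hc hu.2,
    toCornerUnits_eq_one_of_mem _ _ (mem_cornerUnits_one_sub_one_sub hu.1),
    OneMemClass.coe_one, OneMemClass.coe_one, one_mul] at h
  exact h.symm

/-- `U_e U_{1-e} = Rˣ`. [folklore] -/
theorem cornerUnits_sup_cornerUnits_one_sub (he : IsIdempotentElem e) (hc : e ∈ Subring.center R) :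
    cornerUnits e ⊔ cornerUnits (1 - e) = ⊤ := by
  refine top_le_iff.1 fun u _ => ?_
  rw [← toCornerUnits_mul_toCornerUnits he hc u]
  exact Subgroup.mul_mem _ (Subgroup.mem_sup_left (SetLike.coe_mem _))
    (Subgroup.mem_sup_right (SetLike.coe_mem _))

end Ring

/-! ### Topology: the splitting is an isomorphism of topological groups -/

section Topology

variable {R : Type*} [Ring R] [TopologicalSpace R] [IsTopologicalRing R] {e : R}

/-- The Peirce projection is continuous. [folklore] -/
theorem continuous_cornerMonoidHom (he : IsIdempotentElem e) (hc : e ∈ Subring.center R) :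
    Continuous (cornerMonoidHom he hc) :=
  (continuous_const.mul continuous_id).add continuous_const

/-- The projection `Rˣ →* U_e` is continuous (units topologies). [folklore] -/
theorem continuous_toCornerUnits (he : IsIdempotentElem e) (hc : e ∈ Subring.center R) :
    Continuous (toCornerUnits he hc) :=
  continuous_induced_rng.2 (Continuous.units_map _ (continuous_cornerMonoidHom he hc))

/-- `U_e` is closed in `Rˣ` (`R` Hausdorff, or just `T₁`). [folklore] -/
theorem isClosed_cornerUnits [T1Space R] (e : R) : IsClosed ((cornerUnits e : Subgroup Rˣ) : Set Rˣ) :=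
  isClosed_singleton.preimage (continuous_const.mul Units.continuous_val)

/-- **`Rˣ ≃ₜ* U_e × U_{1-e}` as topological groups** (units topologies on `Rˣ` and, by restriction,
on `U_e`, `U_{1-e}`): both `u ↦ (e u + (1 - e), (1 - e) u + e)` and `(a, b) ↦ a b` are continuous.
The abstract form of `GL_n(𝔸_K) ≅ GL_n(K_S) × GL_n(𝔸_K^S)` and `D_𝔸ˣ ≅ D_Sˣ × D^{S,×}`
(Bump (1997), §3.3; Gelbart (1975), §10, p. 153). [folklore] -/
def unitsContinuousEquivCornerUnitsProd (he : IsIdempotentElem e) (hc : e ∈ Subring.center R) :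
    Rˣ ≃ₜ* cornerUnits e × cornerUnits (1 - e) :=
  { unitsEquivCornerUnitsProd he hc with
    continuous_toFun := by
      change Continuous fun u : Rˣ =>
        (toCornerUnits he hc u, toCornerUnits he.one_sub (one_sub_mem_center hc) u)
      exact (continuous_toCornerUnits he hc).prodMk (continuous_toCornerUnits _ _)
    continuous_invFun := by
      change Continuous fun p : cornerUnits e × cornerUnits (1 - e) => (p.1 : Rˣ) * (p.2 : Rˣ)
      exact (continuous_subtype_val.comp continuous_fst).mul (continuous_subtype_val.comp continuous_snd) }

/-- The topological splitting is `u ↦ (e u + (1 - e), (1 - e) u + e)` (definitional). [folklore] -/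
@[simp]
theorem unitsContinuousEquivCornerUnitsProd_apply (he : IsIdempotentElem e) (hc : e ∈ Subring.center R)
    (u : Rˣ) : unitsContinuousEquivCornerUnitsProd he hc u =
      (toCornerUnits he hc u, toCornerUnits he.one_sub (one_sub_mem_center hc) u) := rfl

/-- Its inverse is the product `(a, b) ↦ a b` (definitional). [folklore] -/
@[simp]
theorem unitsContinuousEquivCornerUnitsProd_symm_apply (he : IsIdempotentElem e)
    (hc : e ∈ Subring.center R) (p : cornerUnits e × cornerUnits (1 - e)) :
    (unitsContinuousEquivCornerUnitsProd he hc).symm p = (p.1 : Rˣ) * (p.2 : Rˣ) := rfl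

end Topology

end Literature.Topology.Algebra
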